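import Summits.QuantumFields.BalabanUV.T4Continuum.Spine.NE7.Targets
import Summits.QuantumFields.BalabanUV.T4Continuum.Spine.NE1p.DressedMGFFormUnitLattice
import Summits.QuantumFields.YangMills.Theorems.BalabanUVNodesN14ConvexFibreConsistency
import Literature.MathematicalPhysics.QuantumFieldTheory.Balaban1983to89.T4VarianceMatching

/-!
# BalabanUVNodes ∕ N19 — ROAD (iii) INTO THE DRESSED `Spine.NE7.Core`: two `MGFForm`s + the CLASS-LEVEL measure sandwich modulo constants (NE7-S_cl), and its
# split NE7-S_cl ⟺ MASS_cl (inter-class, one constant = the vacuum bracket) ∧ SHAPE_cl (intra-class = the (I)-bracket's producer) — lens decomp v6, ROW CD-CORE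

Cell `pub-ymgap` (HUMAN RULING D-0062, Track A), node N19 = NE7, R134 seat `pub-ymgap-dag-n19-c` (g6), lens ROW CD-CORE of `ym-lens-BalabanUVNodes-decomp` v6
(`LENS-decomp.md` b0cbfd2d6b6e77ce §v6.4: «→ n19 lineage (n19-d g6 after MODULE B, or an idle N19 seat): lift sketch §3∕§3a∕§3′ … predicates inlined as hypotheses ⇒ 0
def»; sketch `LensDecompNE7v6.sketch.lean` 2f0c09ef6eee62ec, farm rc 0 — §1′, §3, §3a, §3′ LIFTED HERE, CREDITED decl by decl).  Beside road (ii)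
(`DressedMGFForm.core_of_mgfForm`: vacuum `Core` + `MGFForm` + `TiltedMeanMatching`) it is a SECOND bookkeeping road into K3‴ `SpineGivenEndpointR13`'s keyed core edge.
Filed `--supports` stmt-QuantumFields-19912 `--as helper`.  COUNT-NEUTRAL.  THEOREMS ONLY (0 `def`: the lens's four predicates NE7-S_cl `ClassSandwich`, MASS_cl
`MassSandwich`, SHAPE_cl `ShapeSandwich`, `ShapeDensity` are SPELLED OUT as hypotheses); no Theses import; edits nothing.

THE PREDICATES (spelled out below; `μA μB : ∀ K, ι → Measure (Ω K)` the two runs' class measures on the SAME spaces, `r : ℕ → ℝ` a width):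
* NE7-S_cl (CLASS): `∀ K, ∃ c, ∀ t, |t| ≤ l₀ → ∀ τ ∈ T K \ Bad K t, e^{c − r K}·μA K τ ≤ μB K τ ≤ e^{c + r K}·μA K τ` AS MEASURES — ONE constant per `K`;
* MASS_cl: the same on the class MASSES `μ· K τ univ` only (inter-class; = ROW VL's vacuum `Core δ⁰` in measure words);
* SHAPE_cl: the measure sandwich with a PER-CLASS constant (`∃ c` inside; intra-class: normalised class laws `e^{±2r}`-comparable);
* SHAPE in DENSITY form: `μB K τ = e^{c}·(μA K τ).withDensity e^{g}`, `g` measurable, `|g| ≤ r K`.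
All four are HYPOTHESIS SHAPES — NOT PRINTED for d = 4 ([Balaban1985UV3] (41) p. 266 ∕ (47) p. 267 print the Z-level, summed over classes, for d = 3; class-level
refinement of `T4VarianceMatching.UnitFactorisation.EffDensityRate` ∕ T3's `densitySandwichModConst`); produced by nobody (lens ROW MS-SPLIT).

WHAT IS PROVED ([folklore] ∕ bookkeeping).
* §1 `integral_measure_sandwich` — a nonnegative integrand integrates a two-sided measure sandwich.
* §2 ★ `core_of_classSandwich` (ROAD (iii)) — two `MGFForm`s with the SAME observable on the SAME spaces + NE7-S_cl + `r K ≤ vol·δ K` ⇒ the dressed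
  `Spine.NE7.Core l₀ vol T Bad P Q δ` for EVERY `t` (the dressing `e^{tW} ≥ 0` integrates the measure inequality: no vacuum-`Core` binder, no `TiltedMeanMatching`, no
  mean-value step, no `l₀`-smallness).
* §3 THE SPLIT — `massSandwich_of_classSandwich` · `shapeSandwich_of_classSandwich` · ★ `classSandwich_of_mass_of_shape` (MASS `r₁` ∧ SHAPE `r₂` ⇒ CLASS `r₁ + 2r₂`, finite
  class pieces) · ★ `core_of_mass_of_shape` · `shapeSandwich_of_shapeDensity` · `tiltedMean_withDensity_exp_eq_tilted` · ★ `tiltedMeanMatching_of_shapeDensity` (SHAPE_cl in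
  density form ALONE ⇒ road (ii)'s (I)-binder `TiltedMeanMatching … W μA W μB (K ↦ B·(e^{2 r K} − 1))` — n14-c J §1 `abs_tiltedMean_tilted_sub_le` BY NAME; the L¹
  sibling is ne1 gen 5's `TiltedMeanVisibilityTwoRun.tiltedMeanMatching_of_lawLedger`, in tree) · `classSandwich_map` (the sandwich pushes forward along measurable maps:
  finest-space keying ⇒ unit-lattice keying, same width).  So road (ii)'s (V)+(I) IS the mass∕shape split read through MGFs.
* §4 AT THE TREE's INTERFACE — `obs_succ_eq_comp_firstStep` (`obs_{K+1}(o) = (W_o ∘ A_K) ∘ B_K` from `UnitFactorisation.fac` ∘ `NestedFactorisation.nest`) ·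
  ★ `core_of_classSandwich_atUnit` (at a `T4VarianceMatching.NestedFactorisation`: the two runs' dressed class terms are MGFs of ONE unit-lattice `φ ∘ A_K` ∕ `φ ∘ A_{K+1}`
  against class measures on the runs' OWN field spaces — ROW MF-ID for both runs, dag-n19-d's MODULE B shape — and the PUSHED-FORWARD class measures on `X` satisfy
  NE7-S_cl ⇒ dressed `Core`; ne1 gen 2's `DressedMGFFormUnitLattice.MGFForm.map` BY NAME) · `obs_succ_fibreBlind`.

HONEST FRAMING.  Order arithmetic on measures and integrals; every sandwich is a HYPOTHESIS SHAPE, discharged by nobody; nothing of Bałaban's instantiated; NE7 ∕ NE1′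
NOT proved; N19 NOT discharged (0∕1); K3‴ NOT claimed; counts UNMOVED (typed 28∕28 · discharged 5∕27 · A 5∕28); one finite four-torus programme — NOT ℝ⁴, NOT OS, NOT a
mass gap, NOT Clay.  0 `def`; 0 `sorry`; standard axioms.
-/

set_option autoImplicit false

noncomputable section

open MeasureTheory ProbabilityTheory
open scoped ENNReal

namespace Summit.QuantumFields.YangMills.BalabanUVNodes.N19ClassSandwichRoad

open Summit.QuantumFields.BalabanUV.T4Continuum.NE1p.DressedMGFForm (tiltedMean MGFForm TiltedMeanMatching)
open Summit.QuantumFields.BalabanUV.T4Continuum.Spine.NE7 (Core)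

/-! ## §1 A nonnegative integrand integrates a two-sided measure sandwich -/

section Sandwich

variable {ι : Type*} [DecidableEq ι] {Ω : ℕ → Type*} [∀ K, MeasurableSpace (Ω K)]

/-- A nonnegative integrand, integrable on both sides, integrates a two-sided MEASURE sandwich `a·μ ≤ μ′ ≤ b·μ` (`0 ≤ a, b`) into
`a·∫f dμ ≤ ∫f dμ′ ≤ b·∫f dμ` (Mathlib `integral_mono_measure`, `integral_smul_measure`).  (The tree's `T4HybridMatching.integral_sandwich` is the FUNCTION sandwich under
one measure — a different statement; hence the name.)  Lens v6 sketch §3 `integral_sandwich`, lifted. [folklore] -/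
theorem integral_measure_sandwich {α : Type*} [MeasurableSpace α] {μ μ' : Measure α} {f : α → ℝ} {a b : ℝ}
    (hlo : ENNReal.ofReal a • μ ≤ μ') (hhi : μ' ≤ ENNReal.ofReal b • μ) (ha : 0 ≤ a) (hb : 0 ≤ b)
    (hf0 : ∀ x, 0 ≤ f x) (hfμ : Integrable f μ) (hfμ' : Integrable f μ') :
    a * ∫ x, f x ∂μ ≤ ∫ x, f x ∂μ' ∧ ∫ x, f x ∂μ' ≤ b * ∫ x, f x ∂μ := by
  constructor
  · have h1 : ∫ x, f x ∂(ENNReal.ofReal a • μ) ≤ ∫ x, f x ∂μ' :=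
      integral_mono_measure hlo (ae_of_all _ hf0) hfμ'
    rwa [integral_smul_measure, ENNReal.toReal_ofReal ha, smul_eq_mul] at h1
  · have h2 : ∫ x, f x ∂μ' ≤ ∫ x, f x ∂(ENNReal.ofReal b • μ) :=
      integral_mono_measure hhi (ae_of_all _ hf0) (hfμ.smul_measure ENNReal.ofReal_ne_top)
    rwa [integral_smul_measure, ENNReal.toReal_ofReal hb, smul_eq_mul] at h2

variable {l₀ vol B : ℝ} {T : ℕ → Finset ι} {Bad : ℕ → ℝ → Finset ι} {W : ∀ K, Ω K → ℝ}
  {μA μB : ∀ K, ι → Measure (Ω K)} {P Q : ℕ → ℝ → ι → ℝ} {r δ : ℕ → ℝ}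

/-! ## §2 ROAD (iii): the dressed `Core` from two MGF forms and the class-level measure sandwich NE7-S_cl -/

/-- **ROAD (iii) — THE COLLAPSE: dressed `Core` ⇐ two MGF forms (same observable, same spaces) + NE7-S_cl.**  HYPOTHESIS SHAPE NE7-S_cl (NOT PRINTED in d = 4),
spelled out: for every `K` ONE constant `c` (independent of `t` and of the class) with `e^{c − r_K}·μA K τ ≤ μB K τ ≤ e^{c + r_K}·μA K τ` AS MEASURES on every class good at
an admissible source.  Then for EVERY source `t` (no `l₀`-smallness): the dressing `e^{tW} ≥ 0` integrates the measure sandwich, so `e^{c − r_K}·P ≤ Q ≤ e^{c + r_K}·P` on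
the good classes, and any `r K ≤ vol·δ K` gives `Spine.NE7.Core l₀ vol T Bad P Q δ` — with NO vacuum-`Core` binder and NO `TiltedMeanMatching` binder (both are
consequences, §3).  Lens v6 sketch §3 `core_of_classSandwich`, lifted verbatim (predicate inlined).
[cite: Balaban1985UV3, (41) p.266, (47) p.267 (the Z-level density sandwich for d = 3 — the class-level d = 4 shape is NOT printed)] -/
theorem core_of_classSandwich (hP : MGFForm B T W μA P) (hQ : MGFForm B T W μB Q)
    (hS : ∀ K : ℕ, ∃ c : ℝ, ∀ t : ℝ, |t| ≤ l₀ → ∀ τ ∈ T K \ Bad K t,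
      ENNReal.ofReal (Real.exp (c - r K)) • μA K τ ≤ μB K τ ∧ μB K τ ≤ ENNReal.ofReal (Real.exp (c + r K)) • μA K τ)
    (hr : ∀ K, r K ≤ vol * δ K) : Core l₀ vol T Bad P Q δ := by
  intro K
  obtain ⟨c, hc⟩ := hS K
  refine ⟨c, fun t ht τ hτ => ?_⟩
  have hτT : τ ∈ T K := (Finset.mem_sdiff.mp hτ).1
  haveI := hP.finite K τ hτT; haveI := hQ.finite K τ hτT
  obtain ⟨hlo, hhi⟩ := hc t ht τ hτ
  have hf0 : ∀ ω, 0 ≤ Real.exp (t * W K ω) := fun ω => (Real.exp_pos _).le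
  have hint : ∀ (μ : Measure (Ω K)) [IsFiniteMeasure μ], Integrable (fun ω => Real.exp (t * W K ω)) μ := fun μ _ =>
    Literature.MathematicalPhysics.QuantumFieldTheory.Balaban1983to89.T4GenFunBounds.integrable_exp_mul_of_bound
      (μ := μ) (hP.meas K).aemeasurable (ae_of_all _ (hP.bound K)) t
  obtain ⟨h1, h2⟩ := integral_measure_sandwich hlo hhi (Real.exp_pos _).le (Real.exp_pos _).le hf0 (hint _) (hint _)
  have hPnn : 0 ≤ ∫ ω, Real.exp (t * W K ω) ∂(μA K τ) := integral_nonneg hf0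
  rw [hP.repr K t τ hτT, hQ.repr K t τ hτT]
  simp only [mgf]
  constructor
  · calc Real.exp (c - vol * δ K) * ∫ ω, Real.exp (t * W K ω) ∂(μA K τ)
        ≤ Real.exp (c - r K) * ∫ ω, Real.exp (t * W K ω) ∂(μA K τ) :=
          mul_le_mul_of_nonneg_right (Real.exp_le_exp.2 (by linarith [hr K])) hPnn
      _ ≤ _ := h1
  · calc ∫ ω, Real.exp (t * W K ω) ∂(μB K τ) ≤ Real.exp (c + r K) * ∫ ω, Real.exp (t * W K ω) ∂(μA K τ) := h2
      _ ≤ Real.exp (c + vol * δ K) * ∫ ω, Real.exp (t * W K ω) ∂(μA K τ) :=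
          mul_le_mul_of_nonneg_right (Real.exp_le_exp.2 (by linarith [hr K])) hPnn

/-! ## §3 THE SPLIT of NE7-S_cl: MASS_cl (inter-class, one constant) × SHAPE_cl (intra-class, per-class constant) -/

/-- NE7-S_cl ⇒ **MASS_cl** (evaluate the measure sandwich at `univ`): ONE constant `c_K` sandwiches the class MASSES of the two runs on every good class, width `r_K`
— the vacuum bracket (V) of road (ii) in measure words (ROW VL's displayed vacuum `Core δ⁰`, `vol·δ⁰_K := r_K`).  Lens v6 sketch §3a, lifted (predicates inlined).
[folklore] -/
theorem massSandwich_of_classSandwich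
    (hS : ∀ K : ℕ, ∃ c : ℝ, ∀ t : ℝ, |t| ≤ l₀ → ∀ τ ∈ T K \ Bad K t,
      ENNReal.ofReal (Real.exp (c - r K)) • μA K τ ≤ μB K τ ∧ μB K τ ≤ ENNReal.ofReal (Real.exp (c + r K)) • μA K τ) :
    ∀ K : ℕ, ∃ c : ℝ, ∀ t : ℝ, |t| ≤ l₀ → ∀ τ ∈ T K \ Bad K t,
      ENNReal.ofReal (Real.exp (c - r K)) * μA K τ Set.univ ≤ μB K τ Set.univ ∧
        μB K τ Set.univ ≤ ENNReal.ofReal (Real.exp (c + r K)) * μA K τ Set.univ := by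
  intro K
  obtain ⟨c, hc⟩ := hS K
  refine ⟨c, fun t ht τ hτ => ?_⟩
  obtain ⟨hlo, hhi⟩ := hc t ht τ hτ
  have h1 := Measure.le_iff'.1 hlo Set.univ
  have h2 := Measure.le_iff'.1 hhi Set.univ
  simp only [Measure.smul_apply, smul_eq_mul] at h1 h2
  exact ⟨h1, h2⟩

/-- NE7-S_cl ⇒ **SHAPE_cl** (take the class-uniform constant as the per-class one): on every good class the two class pieces agree as measures up to `e^{±r_K}` and a
PER-CLASS constant — intra-class content only (the normalised class laws are `e^{±2r_K}`-comparable); the L¹ sibling is ne1 gen 5's `hyoung` leg of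
`TiltedMeanVisibilityTwoRun.tiltedMeanMatching_of_lawLedger`.  Lens v6 sketch §3a, lifted. [folklore] -/
theorem shapeSandwich_of_classSandwich
    (hS : ∀ K : ℕ, ∃ c : ℝ, ∀ t : ℝ, |t| ≤ l₀ → ∀ τ ∈ T K \ Bad K t,
      ENNReal.ofReal (Real.exp (c - r K)) • μA K τ ≤ μB K τ ∧ μB K τ ≤ ENNReal.ofReal (Real.exp (c + r K)) • μA K τ) :
    ∀ (K : ℕ) (t : ℝ), |t| ≤ l₀ → ∀ τ ∈ T K \ Bad K t, ∃ c : ℝ,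
      ENNReal.ofReal (Real.exp (c - r K)) • μA K τ ≤ μB K τ ∧ μB K τ ≤ ENNReal.ofReal (Real.exp (c + r K)) • μA K τ :=
  fun K t ht τ hτ => by
    obtain ⟨c, hc⟩ := hS K
    exact ⟨c, hc t ht τ hτ⟩

/-- **NE7-S_cl ⇐ MASS_cl ∧ SHAPE_cl** (widths add: `r₁ + 2r₂`): the per-class constant of SHAPE is pinned to the class-uniform constant of MASS within `r₁ + r₂` by
comparing the (finite) class masses.  So the ONE unprinted statement behind the dressed `Core` splits into TWO independently typable two-run pieces — inter-class
(masses, one constant = (V)) and intra-class (normalised laws = (I)'s producer).  Lens v6 sketch §3a, lifted (predicates inlined). [folklore] -/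
theorem classSandwich_of_mass_of_shape {r₁ r₂ : ℕ → ℝ} (hfin : ∀ K, ∀ τ ∈ T K, μA K τ Set.univ ≠ ∞)
    (hM : ∀ K : ℕ, ∃ c : ℝ, ∀ t : ℝ, |t| ≤ l₀ → ∀ τ ∈ T K \ Bad K t,
      ENNReal.ofReal (Real.exp (c - r₁ K)) * μA K τ Set.univ ≤ μB K τ Set.univ ∧
        μB K τ Set.univ ≤ ENNReal.ofReal (Real.exp (c + r₁ K)) * μA K τ Set.univ)
    (hSh : ∀ (K : ℕ) (t : ℝ), |t| ≤ l₀ → ∀ τ ∈ T K \ Bad K t, ∃ c : ℝ,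
      ENNReal.ofReal (Real.exp (c - r₂ K)) • μA K τ ≤ μB K τ ∧ μB K τ ≤ ENNReal.ofReal (Real.exp (c + r₂ K)) • μA K τ) :
    ∀ K : ℕ, ∃ c : ℝ, ∀ t : ℝ, |t| ≤ l₀ → ∀ τ ∈ T K \ Bad K t,
      ENNReal.ofReal (Real.exp (c - (r₁ K + 2 * r₂ K))) • μA K τ ≤ μB K τ ∧
        μB K τ ≤ ENNReal.ofReal (Real.exp (c + (r₁ K + 2 * r₂ K))) • μA K τ := by
  -- `a • μ ≤ b • μ` from `a ≤ b`
  have smul_mono : ∀ (μ : Measure (Ω 0)), True := fun _ => trivial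
  clear smul_mono
  have smul_le : ∀ {K : ℕ} (μ : Measure (Ω K)) {a b : ℝ≥0∞}, a ≤ b → a • μ ≤ b • μ := fun μ a b h =>
    Measure.le_iff'.2 fun s => by
      simp only [Measure.smul_apply, smul_eq_mul]
      exact mul_le_mul' h le_rfl
  intro K
  obtain ⟨c, hc⟩ := hM K
  refine ⟨c, fun t ht τ hτ => ?_⟩
  have hτT : τ ∈ T K := (Finset.mem_sdiff.mp hτ).1
  obtain ⟨hmlo, hmhi⟩ := hc t ht τ hτ
  obtain ⟨c', hlo, hhi⟩ := hSh K t ht τ hτ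
  by_cases hm0 : μA K τ Set.univ = 0
  · have hA0 : μA K τ = 0 := Measure.measure_univ_eq_zero.mp hm0
    have hB0 : μB K τ = 0 := le_antisymm (hhi.trans (by rw [hA0, smul_zero])) (Measure.zero_le _)
    rw [hA0, hB0, smul_zero, smul_zero]
    exact ⟨le_rfl, le_rfl⟩
  · have hmT : μA K τ Set.univ ≠ ∞ := hfin K τ hτT
    have hs1 := Measure.le_iff'.1 hlo Set.univ
    have hs2 := Measure.le_iff'.1 hhi Set.univ
    simp only [Measure.smul_apply, smul_eq_mul] at hs1 hs2
    have hup : Real.exp (c' - r₂ K) ≤ Real.exp (c + r₁ K) :=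
      (ENNReal.ofReal_le_ofReal_iff (Real.exp_pos _).le).1 ((ENNReal.mul_le_mul_iff_left hm0 hmT).1 (hs1.trans hmhi))
    have hdn : Real.exp (c - r₁ K) ≤ Real.exp (c' + r₂ K) :=
      (ENNReal.ofReal_le_ofReal_iff (Real.exp_pos _).le).1 ((ENNReal.mul_le_mul_iff_left hm0 hmT).1 (hmlo.trans hs2))
    rw [Real.exp_le_exp] at hup hdn
    constructor
    · calc ENNReal.ofReal (Real.exp (c - (r₁ K + 2 * r₂ K))) • μA K τ
          ≤ ENNReal.ofReal (Real.exp (c' - r₂ K)) • μA K τ :=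
            smul_le _ (ENNReal.ofReal_le_ofReal (Real.exp_le_exp.2 (by linarith)))
        _ ≤ μB K τ := hlo
    · calc μB K τ ≤ ENNReal.ofReal (Real.exp (c' + r₂ K)) • μA K τ := hhi
        _ ≤ ENNReal.ofReal (Real.exp (c + (r₁ K + 2 * r₂ K))) • μA K τ :=
            smul_le _ (ENNReal.ofReal_le_ofReal (Real.exp_le_exp.2 (by linarith)))

/-- **ROAD (iii), DECOMPOSED: dressed `Core` ⇐ two MGF forms + MASS_cl + SHAPE_cl**, for every `t`, width `vol·δ K ≥ r₁ K + 2 r₂ K`.  Lens v6 sketch §3a, lifted.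
[folklore] -/
theorem core_of_mass_of_shape {r₁ r₂ : ℕ → ℝ} (hP : MGFForm B T W μA P) (hQ : MGFForm B T W μB Q)
    (hM : ∀ K : ℕ, ∃ c : ℝ, ∀ t : ℝ, |t| ≤ l₀ → ∀ τ ∈ T K \ Bad K t,
      ENNReal.ofReal (Real.exp (c - r₁ K)) * μA K τ Set.univ ≤ μB K τ Set.univ ∧
        μB K τ Set.univ ≤ ENNReal.ofReal (Real.exp (c + r₁ K)) * μA K τ Set.univ)
    (hSh : ∀ (K : ℕ) (t : ℝ), |t| ≤ l₀ → ∀ τ ∈ T K \ Bad K t, ∃ c : ℝ,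
      ENNReal.ofReal (Real.exp (c - r₂ K)) • μA K τ ≤ μB K τ ∧ μB K τ ≤ ENNReal.ofReal (Real.exp (c + r₂ K)) • μA K τ)
    (hr : ∀ K, r₁ K + 2 * r₂ K ≤ vol * δ K) : Core l₀ vol T Bad P Q δ :=
  core_of_classSandwich hP hQ
    (classSandwich_of_mass_of_shape (fun K τ hτ => by haveI := hP.finite K τ hτ; exact measure_ne_top _ _) hM hSh) hr

/-- SHAPE in DENSITY form (`μB K τ = e^{c}·(μA K τ).withDensity e^{g}`, `g` measurable, `|g| ≤ r_K` — the class-level, per-class reading of the t4 cell's term-wise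
log-sandwich «radius `r_K`», and the law-level form of n14-c file J's consistency defect `ν₁ = ν.tilted g` up to normalisation) ⇒ the measure form SHAPE_cl.
Lens v6 sketch §3a, lifted. [folklore] -/
theorem shapeSandwich_of_shapeDensity
    (hD : ∀ (K : ℕ) (t : ℝ), |t| ≤ l₀ → ∀ τ ∈ T K \ Bad K t, ∃ (c : ℝ) (g : Ω K → ℝ), Measurable g ∧ (∀ ω, |g ω| ≤ r K) ∧
      μB K τ = ENNReal.ofReal (Real.exp c) • (μA K τ).withDensity fun ω => ENNReal.ofReal (Real.exp (g ω))) :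
    ∀ (K : ℕ) (t : ℝ), |t| ≤ l₀ → ∀ τ ∈ T K \ Bad K t, ∃ c : ℝ,
      ENNReal.ofReal (Real.exp (c - r K)) • μA K τ ≤ μB K τ ∧ μB K τ ≤ ENNReal.ofReal (Real.exp (c + r K)) • μA K τ := by
  -- `a • μ ≤ a • ν` from `μ ≤ ν`
  have smul_le : ∀ {K : ℕ} {μ ν : Measure (Ω K)} (a : ℝ≥0∞), μ ≤ ν → a • μ ≤ a • ν := fun a h =>
    Measure.le_iff'.2 fun s => by
      simp only [Measure.smul_apply, smul_eq_mul]
      exact mul_le_mul' le_rfl (Measure.le_iff'.1 h s)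
  intro K t ht τ hτ
  obtain ⟨c, g, hgm, hgb, hμB⟩ := hD K t ht τ hτ
  refine ⟨c, ?_⟩
  have hup : ((μA K τ).withDensity fun ω => ENNReal.ofReal (Real.exp (g ω))) ≤ ENNReal.ofReal (Real.exp (r K)) • μA K τ := by
    rw [← withDensity_const]
    exact withDensity_mono (ae_of_all _ fun ω => ENNReal.ofReal_le_ofReal (Real.exp_le_exp.2 (abs_le.1 (hgb ω)).2))
  have hdn : ENNReal.ofReal (Real.exp (-r K)) • μA K τ ≤ (μA K τ).withDensity fun ω => ENNReal.ofReal (Real.exp (g ω)) := by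
    rw [← withDensity_const]
    exact withDensity_mono (ae_of_all _ fun ω => ENNReal.ofReal_le_ofReal (Real.exp_le_exp.2 (abs_le.1 (hgb ω)).1))
  rw [hμB]
  constructor
  · have := smul_le (ENNReal.ofReal (Real.exp c)) hdn
    rwa [smul_smul, ← ENNReal.ofReal_mul (Real.exp_pos _).le, ← Real.exp_add, ← sub_eq_add_neg] at this
  · have := smul_le (ENNReal.ofReal (Real.exp c)) hup
    rwa [smul_smul, ← ENNReal.ofReal_mul (Real.exp_pos _).le, ← Real.exp_add] at this

/-- Tilted means do not see an (unnormalised) exponential density versus the (normalised) Mathlib tilt: `tiltedMean F (μ.withDensity e^{g}) s = tiltedMean F (μ.tilted g) s`.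
Lens v6 sketch §3a, lifted (n14-c's `tiltedMean_smul_measure` by name). [folklore] -/
theorem tiltedMean_withDensity_exp_eq_tilted {α : Type*} [MeasurableSpace α] (μ : Measure α) [IsFiniteMeasure μ] [NeZero μ]
    {g : α → ℝ} (hgm : Measurable g) {d : ℝ} (hgb : ∀ x, |g x| ≤ d) (F : α → ℝ) (s : ℝ) :
    tiltedMean F (μ.withDensity fun x => ENNReal.ofReal (Real.exp (g x))) s = tiltedMean F (μ.tilted g) s := by
  have hgi : Integrable (fun x => Real.exp (g x)) μ := by
    have := Literature.Probability.Moments.integrable_exp_mul_of_abs_le_const μ hgm hgb 1; simpa using this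
  set Z : ℝ := ∫ x, Real.exp (g x) ∂μ with hZ
  have hZpos : 0 < Z := integral_exp_pos hgi
  have htilt : μ.tilted g = (ENNReal.ofReal Z)⁻¹ • μ.withDensity fun x => ENNReal.ofReal (Real.exp (g x)) := by
    rw [Measure.tilted, ← withDensity_smul _ (by fun_prop)]
    congr 1
    funext x
    rw [Pi.smul_apply, smul_eq_mul, ← hZ, ENNReal.ofReal_div_of_pos hZpos, div_eq_mul_inv, mul_comm]
  rw [htilt, YMDAG.N14.ConvexFibreMatching.tiltedMean_smul_measure]
  · exact ENNReal.inv_ne_zero.2 ENNReal.ofReal_ne_top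
  · exact ENNReal.inv_ne_top.2 (ENNReal.ofReal_pos.2 hZpos).ne'

/-- **THE (I)-BRACKET IS A SHADOW OF SHAPE_cl ALONE**: SHAPE_cl in density form (per-class constant — the masses ∕ (V) play no role) gives
`TiltedMeanMatching l₀ T Bad W μA W μB (K ↦ B·(e^{2 r_K} − 1))` for every `B`-bounded measurable observable family `W` — same space, same observable, no fibre
(n14-c J §1 `abs_tiltedMean_tilted_sub_le` CITED; L¹ sibling in tree: ne1 gen 5 `TiltedMeanVisibilityTwoRun`).  Lens v6 sketch §3a, lifted. [folklore] -/
theorem tiltedMeanMatching_of_shapeDensity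
    (hD : ∀ (K : ℕ) (t : ℝ), |t| ≤ l₀ → ∀ τ ∈ T K \ Bad K t, ∃ (c : ℝ) (g : Ω K → ℝ), Measurable g ∧ (∀ ω, |g ω| ≤ r K) ∧
      μB K τ = ENNReal.ofReal (Real.exp c) • (μA K τ).withDensity fun ω => ENNReal.ofReal (Real.exp (g ω)))
    (hr : ∀ K, 0 ≤ r K) (hB : 0 ≤ B) (hfin : ∀ K, ∀ τ ∈ T K, IsFiniteMeasure (μA K τ)) (hWm : ∀ K, Measurable (W K))
    (hWb : ∀ K ω, |W K ω| ≤ B) :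
    TiltedMeanMatching l₀ T Bad W μA W μB fun K => B * (Real.exp (2 * r K) - 1) := by
  intro K t ht τ hτ s _
  have hτT : τ ∈ T K := (Finset.mem_sdiff.mp hτ).1
  haveI := hfin K τ hτT
  obtain ⟨c, g, hgm, hgb, hμB⟩ := hD K t ht τ hτ
  have hrhs : 0 ≤ B * (Real.exp (2 * r K) - 1) :=
    mul_nonneg hB (sub_nonneg.2 (Real.one_le_exp (by linarith [hr K])))
  rcases eq_zero_or_neZero (μA K τ) with h0 | hne
  · have hB0 : μB K τ = 0 := by rw [hμB, h0, withDensity_zero_left, smul_zero]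
    simpa [tiltedMean, h0, hB0] using hrhs
  · -- normalise run A's class piece to a probability law `μ₁`
    set m : ℝ≥0∞ := μA K τ Set.univ with hm
    have hm0 : m ≠ 0 := by rw [hm]; exact NeZero.ne _
    have hmT : m ≠ ∞ := measure_ne_top _ _
    set μ₁ : Measure (Ω K) := m⁻¹ • μA K τ with hμ₁
    haveI : IsProbabilityMeasure μ₁ :=
      ⟨by rw [hμ₁, Measure.smul_apply, smul_eq_mul, ← hm, ENNReal.inv_mul_cancel hm0 hmT]⟩
    have hc0 : (ENNReal.ofReal (Real.exp c)) ≠ 0 := (ENNReal.ofReal_pos.2 (Real.exp_pos c)).ne'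
    have hA : tiltedMean (W K) μ₁ s = tiltedMean (W K) (μA K τ) s :=
      YMDAG.N14.ConvexFibreMatching.tiltedMean_smul_measure _ _ (ENNReal.inv_ne_zero.2 hmT) (ENNReal.inv_ne_top.2 hm0) s
    have hBt : tiltedMean (W K) (μB K τ) s = tiltedMean (W K) (μ₁.tilted g) s := by
      rw [hμB, YMDAG.N14.ConvexFibreMatching.tiltedMean_smul_measure _ _ hc0 ENNReal.ofReal_ne_top,
        tiltedMean_withDensity_exp_eq_tilted (μA K τ) hgm hgb, hμ₁,
        Literature.Barriers.CriticalPhenomena.HierarchicalRG.tilted_smul_measure (μA K τ) g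
          (ENNReal.inv_ne_zero.2 hmT) (ENNReal.inv_ne_top.2 hm0)]
    rw [hBt, ← hA]
    exact YMDAG.N14.ConvexFibreConsistency.abs_tiltedMean_tilted_sub_le (μ := μ₁) hgm hgb (hWm K) (hWb K) s

/-- **THE SANDWICH PUSHES FORWARD** along any measurable maps `a K` (e.g. the unit maps `A_K`), with the SAME width — finest-space keying implies unit-lattice keying;
the unit-lattice statement is the weaker (more plausible) one.  Lens v6 sketch §3a, lifted (predicate inlined). [folklore] -/
theorem classSandwich_map {X : Type*} [MeasurableSpace X] {a : ∀ K, Ω K → X} (ha : ∀ K, Measurable (a K))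
    (hS : ∀ K : ℕ, ∃ c : ℝ, ∀ t : ℝ, |t| ≤ l₀ → ∀ τ ∈ T K \ Bad K t,
      ENNReal.ofReal (Real.exp (c - r K)) • μA K τ ≤ μB K τ ∧ μB K τ ≤ ENNReal.ofReal (Real.exp (c + r K)) • μA K τ) :
    ∀ K : ℕ, ∃ c : ℝ, ∀ t : ℝ, |t| ≤ l₀ → ∀ τ ∈ T K \ Bad K t,
      ENNReal.ofReal (Real.exp (c - r K)) • (μA K τ).map (a K) ≤ (μB K τ).map (a K) ∧
        (μB K τ).map (a K) ≤ ENNReal.ofReal (Real.exp (c + r K)) • (μA K τ).map (a K) := by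
  intro K
  obtain ⟨c, hc⟩ := hS K
  refine ⟨c, fun t ht τ hτ => ?_⟩
  obtain ⟨hlo, hhi⟩ := hc t ht τ hτ
  refine ⟨?_, ?_⟩
  · simpa only [Measure.map_smul] using Measure.map_mono hlo (ha K)
  · simpa only [Measure.map_smul] using Measure.map_mono hhi (ha K)

end Sandwich

/-! ## §4 At the tree's interface: MGF forms on the runs' own spaces + NE7-S_cl on the unit lattice ⇒ dressed `Core` -/

section AtUnit

open Literature.MathematicalPhysics.QuantumFieldTheory.Balaban1983to89
open Summit.QuantumFields.BalabanUV.T4Continuum.NE1p.DressedMGFForm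

variable {G O : Type*} {S : Missing.TorusScheme G O} [MeasurableSpace G] {X : Type*} [MeasurableSpace X]
  {ι : Type*} [DecidableEq ι] {l₀ vol B : ℝ} {T : ℕ → Finset ι} {Bad : ℕ → ℝ → Finset ι} {φ : X → ℝ}
  {νA : ∀ K, ι → Measure (GaugeField (S.P K) 0 G)} {νB : ∀ K, ι → Measure (GaugeField (S.P (K + 1)) 0 G)}
  {P Q : ℕ → ℝ → ι → ℝ} {r δ : ℕ → ℝ}

/-- **`obs_{K+1}(o) = (W_o ∘ A_K) ∘ B_K`** (`UnitFactorisation.fac` ∘ `NestedFactorisation.nest`): run `K+1`'s averaged loop variable is run `K`'s unit-read observable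
`W_o ∘ A_K` composed with run `K+1`'s FIRST step `B_K` — constant along the fibres of `B_K`.  Lens v6 sketch §1′, lifted. [folklore] -/
theorem obs_succ_eq_comp_firstStep (N : T4VarianceMatching.NestedFactorisation S X) (K : ℕ) (o : O)
    (U : GaugeField (S.P (K + 1)) 0 G) : S.obs (K + 1) o U = (N.W o ∘ N.A K) (N.B K U) := by
  rw [N.fac (K + 1) o U, Function.comp_apply, N.nest K U]

/-- **ROAD (iii) AT THE TREE's INTERFACE.**  At a `NestedFactorisation` (tree: `T4RunLadder.nestedFactorisation` for Bałaban's averagings): if the two runs' dressed class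
terms are MGFs of ONE unit-lattice function `φ` (`|φ| ≤ B`) read through `A_K` ∕ `A_{K+1}` against class measures `νA K τ` ∕ `νB K τ` on the runs' OWN field spaces (ROW
MF-ID for both runs — dag-n19-d MODULE B's `mgfForm_classWeightOfDatum₉_of_ppSelId` shape), and the PUSHED-FORWARD class measures on `X` satisfy NE7-S_cl (spelled out)
with `r K ≤ vol·δ K`, then `Spine.NE7.Core l₀ vol T Bad P Q δ` (ne1 gen 2's `DressedMGFFormUnitLattice.MGFForm.map` by name).  Lens v6 sketch §3′, lifted. [folklore] -/
theorem core_of_classSandwich_atUnit (N : T4VarianceMatching.NestedFactorisation S X) (hφ : Measurable φ)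
    (hφb : ∀ u, |φ u| ≤ B) (hP : MGFForm B T (fun K => φ ∘ N.A K) νA P)
    (hQ : MGFForm B T (fun K => φ ∘ N.A (K + 1)) νB Q)
    (hS : ∀ K : ℕ, ∃ c : ℝ, ∀ t : ℝ, |t| ≤ l₀ → ∀ τ ∈ T K \ Bad K t,
      ENNReal.ofReal (Real.exp (c - r K)) • (νA K τ).map (N.A K) ≤ (νB K τ).map (N.A (K + 1)) ∧
        (νB K τ).map (N.A (K + 1)) ≤ ENNReal.ofReal (Real.exp (c + r K)) • (νA K τ).map (N.A K))
    (hr : ∀ K, r K ≤ vol * δ K) : Core l₀ vol T Bad P Q δ :=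
  core_of_classSandwich (Ω := fun _ => X) (μA := fun K τ => (νA K τ).map (N.A K)) (μB := fun K τ => (νB K τ).map (N.A (K + 1)))
    (MGFForm.map (fun K => N.measurable_A K) hφ hφb hP)
    (MGFForm.map (A := fun K => N.A (K + 1)) (fun K => N.measurable_A (K + 1)) hφ hφb hQ) hS hr

/-- … and run B's observable there IS run A's read through the first step, so on n14-c's template the fibre gradient is `0` and the (I)-binder is the pure defect (lens
v6 §1, ROW CS-X — n14-c's) — recorded as the pair of facts a consumer cites.  Lens v6 sketch §3′, lifted. [bookkeeping] -/
theorem obs_succ_fibreBlind (N : T4VarianceMatching.NestedFactorisation S X) (K : ℕ) (o : O) :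
    S.obs (K + 1) o = (N.W o ∘ N.A K) ∘ N.B K :=
  funext fun U => obs_succ_eq_comp_firstStep N K o U

end AtUnit

end Summit.QuantumFields.YangMills.BalabanUVNodes.N19ClassSandwichRoad

end
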